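import Summits.QuantumFields.BalabanUV.T4Continuum.Support.NE3EnergyChartLeavesSockets

/-!
# T⁴ programme, node NE3 — (ML_w) TRANSFER: weighted tangent coercivity at the chart's MOVING configuration from ONE
# η-weighted Poincaré–Hodge inequality at the background (supplier piece under row E-MLw-w4)

NE3 (node U1b) formalisation swarm, leaf seat `b2b-balaban-t4-ne3-formalise-leaf-03` (gen 6), supplier piece
**E-MLw-w4-T** (INTENT journal `HOME/CLAIMS.log` 2026-08-20, SHAPE `HOME/t4/formal/NE3/Statements/E-MLw-w4T-SHAPE-v1.md`)
under row E-MLw-w4 of `HOME/t4/formal/NE3/LEAVES.md` v1.45 = owner skeleton `SKELETON-NE3-P1.md` v1.9 §4b, leaf (ML_w)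
`NE3EnergyWeightedShapes.WeightedTangentCoercive` (p217682).

WHY.  The chart composition of the surviving variant (R3) (`NE3EnergyChartLeaves.ChartLeaves`, field `coer`;
`NE3EnergyChartLeavesSockets.coer_of_weightedTangentCoercive_vary`, p218762) consumes (ML_w) AT THE MOVING CONFIGURATION
`vary W X 1 = W·e^{X}` (`W = cavg L U_B` the background, `X = Γ t` the chart path) on the tangent space `T` at the background.
Rows (w1)–(w3) supply (ML_w) at the FLAT configuration only; no moving configuration is flat.  This file isolates what the
chart consumes PER LEVEL as ONE inequality at ONE configuration, the η-weighted covariant Poincaré–Hodge inequality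

  (P_W)   `∀ Y ∈ T, ((L^k)⁻¹)²·dirSq Y F ≤ C_P·curlSq W Y F`

on the tangent space at the background, plus two DISPLAYED smallness regimes (the plaquette radius `a′` of the moving
configuration against `(L^k)²` — the chart regime of sub-row S5-Y8a-1d; the sup `α` of `X` against `L^k` — E-SUP's k-free
`s`), and proves ([folklore]; 0 `def`, 0 sorry):

* §1 `weightedTangentCoercive_mono` ∕ `_anti` — bookkeeping;
* §2 `energyNormW_sq`, `hess_self_ge_window` (road P3's `NE3HessBounds.hessPlaqAt_self_ge` summed over the plaquettes based
  in a site window, with a WINDOWED plaquette radius) and **`weightedTangentCoercive_of_weightedPoincare`** — the (R3) twin of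
  `NE3HessShapes.tangentCoercive_of_poincare`: (P_U) ∧ bond multiplicity `C_b` ∧ `7·a·C_b·C_P·(L^k)² ≤ 1∕n` ⇒
  `WeightedTangentCoercive L k U T ((1∕n − 7aC_bC_P(L^k)²)∕(1 + C_P)) F`;
* §3 **`weightedPoincare_vary`** — transfer of (P) from `U` to `U·e^{X}`: constant `4·C_P` under
  `C_P·(24√d·(e^α − 1)·L^k)² ≤ 1∕4` (road P3's curl transport `NE3EnergyHessContTwoTerm.sqrt_curlSq_vary_le` at `t = −1`);
* §4 END **`weightedTangentCoercive_vary_of_weightedPoincare`**: (P_U) on `T` at the ONE background `U` ⇒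
  `WeightedTangentCoercive L k (vary U X 1) T (1∕(2n(1 + 4C_P))) (periodBox M)` — EXACTLY the hypothesis `hML` of
  `coer_of_weightedTangentCoercive_vary` — and the composed feeder **`coer_of_weightedPoincare`** in the shape of the field
  `ChartLeaves.coer` (norm `energyNormW L k U · (periodBox M)` at the FIXED background, window `periodBox M ×ˢ univ`).

WHAT THIS DOES NOT DO (the open core of (w4), owner's typing): (P_W) at `W = cavg L U_B` on `T(W)` (skew, periodic,
`TangentIter L (k−1) W`, Landau rel. `W`).  At `W = flatCfg` it follows from (w2) + (w3) + the Landau condition.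

HONEST FRAMING.  Inequality bookkeeping at one∕two configurations in OUR repaired frame (context only, nothing printed is a
hypothesis: [Balaban1985BackgroundPropagators] §A (3.10) `Δ = D*D + Δ′`, (3.31)–(3.35), Thm 3.3;
[Balaban1985PropagatorsII] (2.153)); (P_W), (ML_w), T-E_w are NOT proved here; NOTHING about Bałaban's minimisers is
asserted; NE3 NOT proved; spine PROVED 0∕9; finite T⁴ rung (B)+1 — NOT infinite volume, NOT mass gap, NOT BetaPertH, NOT
Clay.  PLACEMENT: `Summits/QuantumFields/BalabanUV/` (our lemmas); imports accepted tree modules only; moves nothing.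
-/

set_option autoImplicit false

open scoped BigOperators Matrix Matrix.Norms.L2Operator
open NormedSpace Finset

namespace Summit.QuantumFields.BalabanUV.T4Continuum.NE3WeightedCoercivityTransfer

open Literature.MathematicalPhysics.QuantumFieldTheory.Balaban1983to89
open B7Prop1Explicit B7Prop2Explicit MatrixLog UnitaryModel
open T4AveragingDeficitWall hiding Site Plane Plaq Bond
open T4AveragingDeficitWallBoundary (periodBox)
open AveragingDeficitPeriodicCounting (IsPeriodicDir)
open AveragingDeficitPlaqDeriv (vary_isUnitaryCfg)
open NE3HessForm (hess hessPlaq hessPlaqAt)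
open NE3HessBounds (bondSq bondSqAt hessPlaqAt_self_ge)
open NE3HessShapes (plaqsOf sum_plaqsOf curlSq_eq_sum_plaqsOf sum_plaqsOf_bondSq_le)
open NE3EnergyHessContTwoTerm (sqrt_curlSq_vary_le curlSq_nonneg dirSq_nonneg)
open NE3EnergyChartLeavesSockets (vary_vary_neg_one coer_of_weightedTangentCoercive_vary)
open NE3EnergyWeightedShapes (energyNormW energyNormW_nonneg WeightedTangentCoercive)

noncomputable section

variable {d : ℕ} {n : Type*} [Fintype n] [DecidableEq n]

/-! ## §1 Bookkeeping on the socket -/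

/-- Monotonicity of (ML_w) in the constant. [folklore] -/
theorem weightedTangentCoercive_mono {L k : ℕ} {W : Site d → Fin d → (Matrix n n ℂ)ˣ}
    {T : Set (Site d → Fin d → Matrix n n ℂ)} {c c' : ℝ} {F : Finset (Site d)}
    (h : WeightedTangentCoercive L k W T c F) (hc : c' ≤ c) : WeightedTangentCoercive L k W T c' F := by
  intro Y hY
  exact (mul_le_mul_of_nonneg_right hc (sq_nonneg _)).trans (h Y hY)

/-- Monotonicity of (ML_w) in the direction set. [folklore] -/
theorem weightedTangentCoercive_anti {L k : ℕ} {W : Site d → Fin d → (Matrix n n ℂ)ˣ}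
    {T T' : Set (Site d → Fin d → Matrix n n ℂ)} {c : ℝ} {F : Finset (Site d)}
    (h : WeightedTangentCoercive L k W T c F) (hT : T' ⊆ T) : WeightedTangentCoercive L k W T' c F :=
  fun Y hY => h Y (hT hY)

/-! ## §2 (ML_w) at one configuration from the weighted Poincaré–Hodge inequality on `T` -/

/-- The square of the weighted energy norm: `energyNormW L k W Z F² = curlSq W Z F + (L^k)⁻²·dirSq Z F`. [folklore] -/
theorem energyNormW_sq (L k : ℕ) (W : Site d → Fin d → (Matrix n n ℂ)ˣ) (Z : Site d → Fin d → Matrix n n ℂ)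
    (F : Finset (Site d)) :
    energyNormW L k W Z F ^ 2 = curlSq W Z F + (((L : ℝ) ^ k)⁻¹) ^ 2 * dirSq Z F := by
  unfold energyNormW
  have hC : 0 ≤ curlSq W Z F := curlSq_nonneg W Z F
  have hD : 0 ≤ dirSq Z F := dirSq_nonneg Z F
  rw [Real.sq_sqrt (by positivity)]

/-- The Hessian over the site window `F ×ˢ univ` is the sum of the plaquette densities over `plaqsOf F`. [folklore] -/
theorem hess_window_eq_sum (V : Site d → Fin d → (Matrix n n ℂ)ˣ) (X Y : Site d → Fin d → Matrix n n ℂ)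
    (F : Finset (Site d)) :
    hess V X Y (F ×ˢ (Finset.univ : Finset (T4AveragingDeficitWall.Plane d))) = ∑ p ∈ plaqsOf F, hessPlaq V X Y p := rfl

/-- **SMALL-FIELD LOWER BOUND ON A SITE WINDOW, WINDOWED RADIUS**: for unitary `U`, skew `Y` and a plaquette radius `a` on
the plaquettes based in `F` (`∀ p ∈ plaqsOf F, ‖U(∂p) − 1‖ ≤ a`):
`curlSq U Y F ∕ n − 7a·Σ_{p ∈ plaqsOf F} bondSq Y p ≤ hess U Y Y (F ×ˢ univ)` — road P3's `hessPlaqAt_self_ge` summed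
(twin of `NE3HessBounds.hess_self_ge`, whose radius hypothesis is the global `SmallField`). [folklore] -/
theorem hess_self_ge_window [Nonempty n] {U : Site d → Fin d → (Matrix n n ℂ)ˣ} (hU : IsUnitaryCfg U)
    {Y : Site d → Fin d → Matrix n n ℂ} (hY : IsSkewDir Y) {a : ℝ} {F : Finset (Site d)}
    (hUa : ∀ p ∈ plaqsOf F, ‖((fhol U p : (Matrix n n ℂ)ˣ) : Matrix n n ℂ) - 1‖ ≤ a) :
    curlSq U Y F / (Fintype.card n : ℝ) - 7 * a * ∑ p ∈ plaqsOf F, bondSq Y p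
      ≤ hess U Y Y (F ×ˢ (Finset.univ : Finset (T4AveragingDeficitWall.Plane d))) := by
  rw [hess_window_eq_sum, curlSq_eq_sum_plaqsOf, Finset.sum_div, Finset.mul_sum, ← Finset.sum_sub_distrib]
  refine Finset.sum_le_sum fun p hp => ?_
  exact hessPlaqAt_self_ge hU hY p.1 p.2.1.1 p.2.1.2 (hUa p hp)

/-- **(ML_w) AT ONE CONFIGURATION FROM THE WEIGHTED POINCARÉ–HODGE INEQUALITY ON `T`** (the (R3) twin of
`NE3HessShapes.tangentCoercive_of_poincare`).  For `1 ≤ L`, unitary `U` with plaquette radius `a ≥ 0` on the plaquettes based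
in `F`, skew directions `T`, constants `C_P, C_b ≥ 0` with
(P_U) `∀ Y ∈ T, (L^k)⁻²·dirSq Y F ≤ C_P·curlSq U Y F` and the bond multiplicity `Σ_{plaqsOf F} bondSq Y ≤ C_b·dirSq Y F` on `T`,
under the DISPLAYED regime `7·a·C_b·C_P·(L^k)² ≤ 1∕n` (`n = Fintype.card n`):
`WeightedTangentCoercive L k U T ((1∕n − 7·a·C_b·C_P·(L^k)²) ∕ (1 + C_P)) F`.  The regime is a smallness of `a·(L^k)²` —
the chart's `a′ = O(L^{−2k})` (S5-Y8a-1d) — and the constant is k-free when `C_P` is. [folklore] -/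
theorem weightedTangentCoercive_of_weightedPoincare [Nonempty n] {L : ℕ} (hL : 1 ≤ L) (k : ℕ)
    {U : Site d → Fin d → (Matrix n n ℂ)ˣ} (hU : IsUnitaryCfg U) {a : ℝ} (ha : 0 ≤ a) {F : Finset (Site d)}
    (hUa : ∀ p ∈ plaqsOf F, ‖((fhol U p : (Matrix n n ℂ)ˣ) : Matrix n n ℂ) - 1‖ ≤ a)
    {T : Set (Site d → Fin d → Matrix n n ℂ)} (hskew : ∀ Y ∈ T, IsSkewDir Y)
    {CP Cb : ℝ} (hCP : 0 ≤ CP) (hCb : 0 ≤ Cb)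
    (hP : ∀ Y ∈ T, (((L : ℝ) ^ k)⁻¹) ^ 2 * dirSq Y F ≤ CP * curlSq U Y F)
    (hb : ∀ Y ∈ T, ∑ p ∈ plaqsOf F, bondSq Y p ≤ Cb * dirSq Y F)
    (hsmall : 7 * a * Cb * CP * ((L : ℝ) ^ k) ^ 2 ≤ 1 / (Fintype.card n : ℝ)) :
    WeightedTangentCoercive L k U T
      ((1 / (Fintype.card n : ℝ) - 7 * a * Cb * CP * ((L : ℝ) ^ k) ^ 2) / (1 + CP)) F := by
  intro Y hY
  have hge := hess_self_ge_window hU (hskew Y hY) hUa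
  have hPY := hP Y hY
  have hbY := hb Y hY
  set s : ℝ := (L : ℝ) ^ k with hs
  have hs0 : 0 < s := by rw [hs]; exact pow_pos (by exact_mod_cast hL) k
  set C : ℝ := curlSq U Y F with hC
  set Dr : ℝ := dirSq Y F with hDr
  set D : ℝ := (s⁻¹) ^ 2 * Dr with hD
  have hC0 : 0 ≤ C := by rw [hC]; exact curlSq_nonneg U Y F
  have hDr0 : 0 ≤ Dr := by rw [hDr]; exact dirSq_nonneg Y F
  have hD0 : 0 ≤ D := by rw [hD]; positivity
  -- `dirSq = s²·D`
  have hDrD : Dr = s ^ 2 * D := by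
    rw [hD]; field_simp
  -- the radius term against the curl: `7a·Σ bondSq ≤ 7a·Cb·CP·s²·C`
  have h7 : 7 * a * ∑ p ∈ plaqsOf F, bondSq Y p ≤ 7 * a * Cb * CP * s ^ 2 * C := by
    have h1 : ∑ p ∈ plaqsOf F, bondSq Y p ≤ Cb * (s ^ 2 * D) := by rw [← hDrD]; exact hbY
    have h2 : Cb * (s ^ 2 * D) ≤ Cb * (s ^ 2 * (CP * C)) :=
      mul_le_mul_of_nonneg_left (mul_le_mul_of_nonneg_left hPY (sq_nonneg _)) hCb
    have h3 := mul_le_mul_of_nonneg_left (h1.trans h2) (by positivity : (0:ℝ) ≤ 7 * a)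
    linarith
  have h1 : (1 / (Fintype.card n : ℝ) - 7 * a * Cb * CP * s ^ 2) * C
      ≤ hess U Y Y (F ×ˢ (Finset.univ : Finset (T4AveragingDeficitWall.Plane d))) := by
    have : C / (Fintype.card n : ℝ) = 1 / (Fintype.card n : ℝ) * C := by ring
    linarith
  -- `energyNormW² = C + D ≤ (1 + CP)·C`
  have h2 : energyNormW L k U Y F ^ 2 ≤ (1 + CP) * C := by
    rw [energyNormW_sq]; show C + D ≤ (1 + CP) * C; nlinarith
  have h1P : 0 < 1 + CP := by linarith
  have hsign : 0 ≤ 1 / (Fintype.card n : ℝ) - 7 * a * Cb * CP * s ^ 2 := by linarith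
  rw [div_mul_eq_mul_div, div_le_iff₀ h1P]
  calc (1 / (Fintype.card n : ℝ) - 7 * a * Cb * CP * s ^ 2) * energyNormW L k U Y F ^ 2
      ≤ (1 / (Fintype.card n : ℝ) - 7 * a * Cb * CP * s ^ 2) * ((1 + CP) * C) :=
        mul_le_mul_of_nonneg_left h2 hsign
    _ = (1 / (Fintype.card n : ℝ) - 7 * a * Cb * CP * s ^ 2) * C * (1 + CP) := by ring
    _ ≤ hess U Y Y (F ×ˢ (Finset.univ : Finset (T4AveragingDeficitWall.Plane d))) * (1 + CP) :=
        mul_le_mul_of_nonneg_right h1 h1P.le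

/-- The torus instance of §2: for `M`-periodic skew directions the bond multiplicity is `C_b = 4d`
(`NE3HessShapes.sum_plaqsOf_bondSq_le`), so (P_U) on `T` and `28·d·a·C_P·(L^k)² ≤ 1∕n` give
`WeightedTangentCoercive L k U T ((1∕n − 28·d·a·C_P·(L^k)²) ∕ (1 + C_P)) (periodBox M)`. [folklore] -/
theorem weightedTangentCoercive_of_weightedPoincare_periodBox [Nonempty n] {L : ℕ} (hL : 1 ≤ L) (k : ℕ)
    {U : Site d → Fin d → (Matrix n n ℂ)ˣ} (hU : IsUnitaryCfg U) {a : ℝ} (ha : 0 ≤ a) {M : ℕ} (hM : 1 ≤ M)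
    (hUa : ∀ p ∈ plaqsOf (periodBox M), ‖((fhol U p : (Matrix n n ℂ)ˣ) : Matrix n n ℂ) - 1‖ ≤ a)
    {T : Set (Site d → Fin d → Matrix n n ℂ)} (hskew : ∀ Y ∈ T, IsSkewDir Y)
    (hper : ∀ Y ∈ T, IsPeriodicDir Y (M : ℤ)) {CP : ℝ} (hCP : 0 ≤ CP)
    (hP : ∀ Y ∈ T, (((L : ℝ) ^ k)⁻¹) ^ 2 * dirSq Y (periodBox M) ≤ CP * curlSq U Y (periodBox M))
    (hsmall : 28 * (d : ℝ) * a * CP * ((L : ℝ) ^ k) ^ 2 ≤ 1 / (Fintype.card n : ℝ)) :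
    WeightedTangentCoercive L k U T
      ((1 / (Fintype.card n : ℝ) - 28 * (d : ℝ) * a * CP * ((L : ℝ) ^ k) ^ 2) / (1 + CP)) (periodBox M) := by
  have hb : ∀ Y ∈ T, ∑ p ∈ plaqsOf (periodBox M), bondSq Y p ≤ (4 * (d : ℝ)) * dirSq Y (periodBox M) :=
    fun Y hY => sum_plaqsOf_bondSq_le (n := n) hM (hper Y hY)
  have h4d : (0 : ℝ) ≤ 4 * (d : ℝ) := by positivity
  have hsmall' : 7 * a * (4 * (d : ℝ)) * CP * ((L : ℝ) ^ k) ^ 2 ≤ 1 / (Fintype.card n : ℝ) := by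
    have : 7 * a * (4 * (d : ℝ)) * CP * ((L : ℝ) ^ k) ^ 2 = 28 * (d : ℝ) * a * CP * ((L : ℝ) ^ k) ^ 2 := by ring
    rw [this]; exact hsmall
  have h := weightedTangentCoercive_of_weightedPoincare hL k hU ha hUa hskew hCP h4d hP hb hsmall'
  have heq : (1 / (Fintype.card n : ℝ) - 7 * a * (4 * (d : ℝ)) * CP * ((L : ℝ) ^ k) ^ 2) / (1 + CP)
      = (1 / (Fintype.card n : ℝ) - 28 * (d : ℝ) * a * CP * ((L : ℝ) ^ k) ^ 2) / (1 + CP) := by ring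
  rw [heq] at h
  exact h

/-! ## §3 Transfer of the weighted Poincaré–Hodge inequality from `U` to `U·e^{X}` -/

/-- Real arithmetic of the transfer: from `√C₀ ≤ √C₁ + E·√D`, `D ≤ C_P·C₀` and `C_P·E² ≤ 1∕4` conclude `D ≤ 4·C_P·C₁`
(square, `(x + y)² ≤ 2x² + 2y²`, absorb `2·C_P·E²·D ≤ D∕2`). [folklore] -/
theorem transfer_arith {C₀ C₁ D E CP : ℝ} (hC₀ : 0 ≤ C₀) (hC₁ : 0 ≤ C₁) (hD : 0 ≤ D) (hE : 0 ≤ E) (hCP : 0 ≤ CP)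
    (htr : Real.sqrt C₀ ≤ Real.sqrt C₁ + E * Real.sqrt D) (hP : D ≤ CP * C₀) (hreg : CP * E ^ 2 ≤ 1 / 4) :
    D ≤ 4 * CP * C₁ := by
  have h0 : 0 ≤ Real.sqrt C₁ + E * Real.sqrt D := by positivity
  have h1 : Real.sqrt C₀ ^ 2 ≤ (Real.sqrt C₁ + E * Real.sqrt D) ^ 2 :=
    pow_le_pow_left₀ (Real.sqrt_nonneg _) htr 2
  rw [Real.sq_sqrt hC₀] at h1
  have h2 : (Real.sqrt C₁ + E * Real.sqrt D) ^ 2 ≤ 2 * Real.sqrt C₁ ^ 2 + 2 * (E * Real.sqrt D) ^ 2 := by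
    nlinarith [sq_nonneg (Real.sqrt C₁ - E * Real.sqrt D)]
  rw [Real.sq_sqrt hC₁, mul_pow, Real.sq_sqrt hD] at h2
  have hsq : C₀ ≤ 2 * C₁ + 2 * E ^ 2 * D := by linarith
  have habsorb : 2 * CP * E ^ 2 * D ≤ D / 2 := by
    have := mul_le_mul_of_nonneg_right hreg hD
    nlinarith
  have h3 : D ≤ 2 * CP * C₁ + 2 * CP * E ^ 2 * D := by
    have := mul_le_mul_of_nonneg_left hsq hCP
    nlinarith
  nlinarith

/-- **TRANSFER OF (P) ALONG A BOUNDED EXPONENTIAL VARIATION**: for `1 ≤ L`, unitary `U`, skew `X` with `‖X(b)‖ ≤ α`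
(`α ≥ 0`), `1 ≤ M`, an `M`-periodic direction `Y` with (P_U) `(L^k)⁻²·dirSq Y ≤ C_P·curlSq U Y` over `periodBox M`, and the
DISPLAYED regime `C_P·(24√d·(e^α − 1)·L^k)² ≤ 1∕4`:
`(L^k)⁻²·dirSq Y ≤ 4·C_P·curlSq (U·e^{X}) Y` over `periodBox M`.
Proof: road P3's curl transport `sqrt_curlSq_vary_le` from `U·e^{X}` back to `U` (`t = −1`, `vary_vary_neg_one`):
`√curlSq_U ≤ √curlSq_{Ue^X} + 24√d(e^α − 1)·L^k·√((L^k)⁻²dirSq)`, square and absorb (`transfer_arith`).  The regime is a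
smallness of `(e^α − 1)·L^k`, i.e. of E-SUP's k-free sup constant `s` (`α ≤ s·L^{−k}`). [folklore] -/
theorem weightedPoincare_vary [Nonempty n] {L : ℕ} (hL : 1 ≤ L) (k : ℕ)
    {U : Site d → Fin d → (Matrix n n ℂ)ˣ} (hU : IsUnitaryCfg U) {X : Site d → Fin d → Matrix n n ℂ} (hX : IsSkewDir X)
    {α : ℝ} (hα : 0 ≤ α) (hXα : ∀ x κ, ‖X x κ‖ ≤ α) {M : ℕ} (hM : 1 ≤ M)
    {Y : Site d → Fin d → Matrix n n ℂ} (hY : IsPeriodicDir Y (M : ℤ)) {CP : ℝ} (hCP : 0 ≤ CP)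
    (hP : (((L : ℝ) ^ k)⁻¹) ^ 2 * dirSq Y (periodBox M) ≤ CP * curlSq U Y (periodBox M))
    (hreg : CP * (24 * Real.sqrt d * (Real.exp α - 1) * (L : ℝ) ^ k) ^ 2 ≤ 1 / 4) :
    (((L : ℝ) ^ k)⁻¹) ^ 2 * dirSq Y (periodBox M) ≤ 4 * CP * curlSq (vary U X 1) Y (periodBox M) := by
  have hWt : IsUnitaryCfg (vary U X 1) := vary_isUnitaryCfg hU hX 1
  have htr := sqrt_curlSq_vary_le hWt hX hα hXα (-1) hM hY
  rw [vary_vary_neg_one] at htr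
  have habs : |(-1 : ℝ)| * α = α := by simp
  rw [habs] at htr
  -- abstract the three functionals
  have hC₀0 := curlSq_nonneg U Y (periodBox M)
  have hC₁0 := curlSq_nonneg (vary U X 1) Y (periodBox M)
  have hDr0 := dirSq_nonneg Y (periodBox (d := d) M)
  generalize curlSq U Y (periodBox M) = C₀ at htr hP hC₀0 ⊢
  generalize curlSq (vary U X 1) Y (periodBox M) = C₁ at htr hC₁0 ⊢
  generalize dirSq Y (periodBox M) = Dr at htr hP hDr0 ⊢
  have hs0 : (0 : ℝ) < (L : ℝ) ^ k := pow_pos (by exact_mod_cast hL) k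
  have hδ0 : 0 ≤ Real.exp α - 1 := by linarith [Real.add_one_le_exp α]
  -- `√dirSq = L^k·√((L^k)⁻²·dirSq)`
  have hD0 : 0 ≤ (((L : ℝ) ^ k)⁻¹) ^ 2 * Dr := by positivity
  have hsqDr : Real.sqrt Dr = (L : ℝ) ^ k * Real.sqrt ((((L : ℝ) ^ k)⁻¹) ^ 2 * Dr) := by
    rw [Real.sqrt_mul (sq_nonneg _), Real.sqrt_sq (inv_nonneg.mpr hs0.le), ← mul_assoc,
      mul_inv_cancel₀ hs0.ne', one_mul]
  have hE0 : 0 ≤ 24 * Real.sqrt d * (Real.exp α - 1) * (L : ℝ) ^ k := by positivity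
  have htr' : Real.sqrt C₀ ≤ Real.sqrt C₁
      + (24 * Real.sqrt d * (Real.exp α - 1) * (L : ℝ) ^ k) * Real.sqrt ((((L : ℝ) ^ k)⁻¹) ^ 2 * Dr) := by
    have : 24 * Real.sqrt d * (Real.exp α - 1) * Real.sqrt Dr
        = (24 * Real.sqrt d * (Real.exp α - 1) * (L : ℝ) ^ k) * Real.sqrt ((((L : ℝ) ^ k)⁻¹) ^ 2 * Dr) := by
      rw [hsqDr]; ring
    linarith [htr, this]
  exact transfer_arith hC₀0 hC₁0 hD0 hE0 hCP htr' hP hreg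

/-! ## §4 END: (ML_w) at the moving configuration, and the chart's `coer` field, from (P_U) at the background -/

/-- **END — (ML_w) AT THE CHART'S MOVING CONFIGURATION FROM (P_U) AT THE ONE BACKGROUND.**  For `1 ≤ L`, unitary `U`,
skew `X` with `‖X(b)‖ ≤ α` (`α ≥ 0`), `1 ≤ M`, a set `T` of skew `M`-periodic directions with
(P_U) `∀ Y ∈ T, (L^k)⁻²·dirSq Y ≤ C_P·curlSq U Y` over `periodBox M` (`C_P ≥ 0`), a plaquette radius `a′ ≥ 0` of the moving
configuration `U·e^{X}` on the plaquettes based in `periodBox M`, and the two DISPLAYED regimes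
`C_P·(24√d·(e^α − 1)·L^k)² ≤ 1∕4` and `112·d·a′·C_P·(L^k)² ≤ 1∕(2n)`:
`WeightedTangentCoercive L k (vary U X 1) T (1 ∕ (2n·(1 + 4C_P))) (periodBox M)` — EXACTLY the hypothesis `hML` of
`NE3EnergyChartLeavesSockets.coer_of_weightedTangentCoercive_vary` at `W := U` (`= cavg L U_B`), `X := Γ t`. [folklore] -/
theorem weightedTangentCoercive_vary_of_weightedPoincare [Nonempty n] {L : ℕ} (hL : 1 ≤ L) (k : ℕ)
    {U : Site d → Fin d → (Matrix n n ℂ)ˣ} (hU : IsUnitaryCfg U) {X : Site d → Fin d → Matrix n n ℂ} (hX : IsSkewDir X)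
    {α : ℝ} (hα : 0 ≤ α) (hXα : ∀ x κ, ‖X x κ‖ ≤ α) {M : ℕ} (hM : 1 ≤ M)
    {T : Set (Site d → Fin d → Matrix n n ℂ)} (hskew : ∀ Y ∈ T, IsSkewDir Y) (hper : ∀ Y ∈ T, IsPeriodicDir Y (M : ℤ))
    {a' : ℝ} (ha' : 0 ≤ a')
    (hsmall' : ∀ p ∈ plaqsOf (periodBox M), ‖((fhol (vary U X 1) p : (Matrix n n ℂ)ˣ) : Matrix n n ℂ) - 1‖ ≤ a')
    {CP : ℝ} (hCP : 0 ≤ CP)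
    (hP : ∀ Y ∈ T, (((L : ℝ) ^ k)⁻¹) ^ 2 * dirSq Y (periodBox M) ≤ CP * curlSq U Y (periodBox M))
    (hreg₁ : CP * (24 * Real.sqrt d * (Real.exp α - 1) * (L : ℝ) ^ k) ^ 2 ≤ 1 / 4)
    (hreg₂ : 112 * (d : ℝ) * a' * CP * ((L : ℝ) ^ k) ^ 2 ≤ 1 / (2 * (Fintype.card n : ℝ))) :
    WeightedTangentCoercive L k (vary U X 1) T (1 / (2 * (Fintype.card n : ℝ) * (1 + 4 * CP))) (periodBox M) := by
  have hWt : IsUnitaryCfg (vary U X 1) := vary_isUnitaryCfg hU hX 1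
  have h4CP : (0 : ℝ) ≤ 4 * CP := by positivity
  -- (P) at the moving configuration with constant `4·CP`
  have hPt : ∀ Y ∈ T, (((L : ℝ) ^ k)⁻¹) ^ 2 * dirSq Y (periodBox M) ≤ (4 * CP) * curlSq (vary U X 1) Y (periodBox M) :=
    fun Y hY => weightedPoincare_vary hL k hU hX hα hXα hM (hper Y hY) hCP (hP Y hY) hreg₁
  have hn : (0 : ℝ) < (Fintype.card n : ℝ) := by exact_mod_cast Fintype.card_pos
  -- the radius regime for `C_P ↦ 4·C_P`: `28·d·a′·(4CP)·(L^k)² = 112·d·a′·CP·(L^k)² ≤ 1∕(2n) ≤ 1∕n`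
  have hsmall : 28 * (d : ℝ) * a' * (4 * CP) * ((L : ℝ) ^ k) ^ 2 ≤ 1 / (Fintype.card n : ℝ) := by
    have h1 : 28 * (d : ℝ) * a' * (4 * CP) * ((L : ℝ) ^ k) ^ 2 = 112 * (d : ℝ) * a' * CP * ((L : ℝ) ^ k) ^ 2 := by ring
    have h2 : 1 / (2 * (Fintype.card n : ℝ)) ≤ 1 / (Fintype.card n : ℝ) := by
      rw [div_le_div_iff₀ (by positivity) hn]; nlinarith
    rw [h1]; exact hreg₂.trans h2
  have h := weightedTangentCoercive_of_weightedPoincare_periodBox hL k hWt ha' hM hsmall' hskew hper h4CP hPt hsmall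
  refine weightedTangentCoercive_mono h ?_
  -- `1∕(2n(1+4CP)) ≤ (1∕n − 112·d·a′·CP·(L^k)²)∕(1+4CP)`
  have h1P : (0 : ℝ) < 1 + 4 * CP := by linarith
  have hK : 28 * (d : ℝ) * a' * (4 * CP) * ((L : ℝ) ^ k) ^ 2 ≤ 1 / (2 * (Fintype.card n : ℝ)) := by
    have h1 : 28 * (d : ℝ) * a' * (4 * CP) * ((L : ℝ) ^ k) ^ 2 = 112 * (d : ℝ) * a' * CP * ((L : ℝ) ^ k) ^ 2 := by ring
    rw [h1]; exact hreg₂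
  have hhalf : 1 / (2 * (Fintype.card n : ℝ)) ≤ 1 / (Fintype.card n : ℝ) - 28 * (d : ℝ) * a' * (4 * CP) * ((L : ℝ) ^ k) ^ 2 := by
    have : 1 / (Fintype.card n : ℝ) = 1 / (2 * (Fintype.card n : ℝ)) + 1 / (2 * (Fintype.card n : ℝ)) := by
      field_simp; ring
    linarith
  calc 1 / (2 * (Fintype.card n : ℝ) * (1 + 4 * CP)) = (1 / (2 * (Fintype.card n : ℝ))) / (1 + 4 * CP) := by
        rw [div_div]
    _ ≤ (1 / (Fintype.card n : ℝ) - 28 * (d : ℝ) * a' * (4 * CP) * ((L : ℝ) ^ k) ^ 2) / (1 + 4 * CP) :=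
        div_le_div_of_nonneg_right hhalf h1P.le

/-- **THE CHART'S `coer` FIELD FROM (P_U) AT THE BACKGROUND** (composition of the END with
`NE3EnergyChartLeavesSockets.coer_of_weightedTangentCoercive_vary`): under the hypotheses of
`weightedTangentCoercive_vary_of_weightedPoincare`, for every `Y ∈ T`:
`c⋆ · energyNormW L k U Y (periodBox M)² ≤ hess (U·e^{X}) Y Y (periodBox M ×ˢ univ)` with
`c⋆ = (1∕(2n(1 + 4C_P))) ∕ (2 + 24√d·(e^α − 1)·L^k)²` — the shape of `NE3EnergyChartLeaves.ChartLeaves.coer` at time `t`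
(`U := cavg L U_B`, `X := Γ t`, `Nrm := energyNormW L k (cavg L U_B) · (periodBox (N·L^k))`, window
`perWin d (N·L^k) = periodBox (N·L^k) ×ˢ univ`), k-free under the two regimes when `C_P` is. [folklore] -/
theorem coer_of_weightedPoincare [Nonempty n] {L : ℕ} (hL : 1 ≤ L) (k : ℕ)
    {U : Site d → Fin d → (Matrix n n ℂ)ˣ} (hU : IsUnitaryCfg U) {X : Site d → Fin d → Matrix n n ℂ} (hX : IsSkewDir X)
    {α : ℝ} (hα : 0 ≤ α) (hXα : ∀ x κ, ‖X x κ‖ ≤ α) {M : ℕ} (hM : 1 ≤ M)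
    {T : Set (Site d → Fin d → Matrix n n ℂ)} (hskew : ∀ Y ∈ T, IsSkewDir Y) (hper : ∀ Y ∈ T, IsPeriodicDir Y (M : ℤ))
    {a' : ℝ} (ha' : 0 ≤ a')
    (hsmall' : ∀ p ∈ plaqsOf (periodBox M), ‖((fhol (vary U X 1) p : (Matrix n n ℂ)ˣ) : Matrix n n ℂ) - 1‖ ≤ a')
    {CP : ℝ} (hCP : 0 ≤ CP)
    (hP : ∀ Y ∈ T, (((L : ℝ) ^ k)⁻¹) ^ 2 * dirSq Y (periodBox M) ≤ CP * curlSq U Y (periodBox M))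
    (hreg₁ : CP * (24 * Real.sqrt d * (Real.exp α - 1) * (L : ℝ) ^ k) ^ 2 ≤ 1 / 4)
    (hreg₂ : 112 * (d : ℝ) * a' * CP * ((L : ℝ) ^ k) ^ 2 ≤ 1 / (2 * (Fintype.card n : ℝ)))
    {Y : Site d → Fin d → Matrix n n ℂ} (hYT : Y ∈ T) :
    (1 / (2 * (Fintype.card n : ℝ) * (1 + 4 * CP))) / (2 + 24 * Real.sqrt d * (Real.exp α - 1) * (L : ℝ) ^ k) ^ 2
        * energyNormW L k U Y (periodBox M) ^ 2
      ≤ hess (vary U X 1) Y Y (periodBox M ×ˢ (Finset.univ : Finset (T4AveragingDeficitWall.Plane d))) := by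
  have hML := weightedTangentCoercive_vary_of_weightedPoincare hL k hU hX hα hXα hM hskew hper ha' hsmall' hCP hP hreg₁ hreg₂
  have hc : (0 : ℝ) ≤ 1 / (2 * (Fintype.card n : ℝ) * (1 + 4 * CP)) := by positivity
  exact coer_of_weightedTangentCoercive_vary hL k hU hX hα hXα hM hc hML hYT (hper Y hYT)

end

end Summit.QuantumFields.BalabanUV.T4Continuum.NE3WeightedCoercivityTransfer
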